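import Literature.AlgebraicGeometry.Frobenioids.UnitWiseFrobeniusExists
import Literature.AlgebraicGeometry.Frobenioids.NaiveFrobeniusFunctorProofs
import HarnessLib

/-!
# Frobenioids I, Corollary 2.6: the named statement `UnitWiseFrobeniusExists`, unconditionally

Mochizuki, *The geometry of Frobenioids I: the general theory*, Kyushu J. Math. **62** (2008)
293–400, §2, Corollary 2.6, kurims text pp. 50–51 [cite: MochizukiFrdI2008, Cor. 2.6 p.50].

`UnitWiseFrobeniusExists.lean` proves Cor. 2.6 conditionally on Prop. 2.1 (iii)
(`NaiveFrobeniusEquivalenceOfPerfect F d`); `NaiveFrobeniusFunctorProofs.lean` proves Prop. 2.1 (iii)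
(`naiveFrobeniusEquivalenceOfPerfect_holds`).  This file combines the two.

Provenance: typed/proved by abc-iut-L6-t9 (prover-abc-iut-L6-t9-g0-0; staged HOME/staging/L1/L6-t9/,
MANIFEST.txt, session ended 2026-08-25T23:52Z inviting any seat to file verbatim); filed verbatim by
abc-iut-w5-d248 as filer-of-record (L1-lead ruling R82 (4), 2026-08-26T00:16:47Z) after re-verification
against the current tree (only change: fully-qualified closing types where applicable, and this note).
-/

namespace Literature.AlgebraicGeometry.Frobenioids

open CategoryTheory

universe w v v' u u'

namespace PreFrobenioid

variable {D : Type u} [Category.{v} D] {Φ : Dᵒᵖ ⥤ CommMonCat.{w}}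
  {C : Type u'} [Category.{v'} C] {F : C ⥤ ElemFrobenioid Φ}

/-- **Cor. 2.6** (unit-wise Frobenius functors) — the named statement `UnitWiseFrobeniusExists F d` of
`CharacteristicSplitting.lean` holds for every `d ≥ 1`. [cite: MochizukiFrdI2008, Cor. 2.6 p.50] -/
theorem unitWiseFrobeniusExists (d : ℕ+) :
    Literature.AlgebraicGeometry.Frobenioids.PreFrobenioid.UnitWiseFrobeniusExists F d :=
  unitWiseFrobeniusExists_of_naiveEquivalence d (naiveFrobeniusEquivalenceOfPerfect_holds d)

end PreFrobenioid

end Literature.AlgebraicGeometry.Frobenioids
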